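import Summits.CriticalPhenomena.SAWScalingLimit.Theorems.SAWLoopFugacityFlowSimpleSubseqLimitsSlitLine
import HarnessLib

/-!
# Split glue for the crux `SimpleSubseqLimits` (stmt-CriticalPhenomena-4982), route SAWLoopFugacityFlow rev 4:
# `SlitSplitGlue : SeqSlitAvoidance → LimitAvoidanceValues → SimpleSubseqLimits` (stmt-CriticalPhenomena-18171), PROVED

Paste-ready Theorems file prepared by the crux-strategist re-exam seat `cstrat-stmt-CriticalPhenomena-4982-r1`
(2026-08-17) for a PROVER to land (Theorems/ is prover-only):
`ledger propose --kind proof --target Summits/CriticalPhenomena/SAWScalingLimit/Theorems/SAWLoopFugacityFlowSimpleSubseqLimitsSplit.lean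
 --file <this file> --workitem stmt-CriticalPhenomena-18171`.
Content: the route decls `SeqSlitAvoidance` / `LimitAvoidanceValues` are the landed `Transfer.SequentialSlitAvoidance` /
`PastShadowing.Main.AvoidanceValues` definitionally (`Iff.rfl`), so the glue item is the route-neutral core of the landed line
`slit-continuous-restriction` (`SlitRestriction.Line.core_of_seqSlitAvoidance`, p154999) followed by
`Negative.simpleSubseqLimits_iff_core`; the by-name assembly `SeqSlitAvoidance → AvoidanceLimit → SimpleSubseqLimits` is the landed
`line_slitContinuousRestriction` itself. No sorry; axioms propext / Classical.choice / Quot.sound (lean check rc 0).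
-/

noncomputable section

open MeasureTheory Filter Topology Set Metric Function
open Literature.Probability.RandomPlanarGeometry Literature.Probability.RandomPlanarGeometry.SAW
open Literature.Probability.LatticeModels
open scoped ENNReal NNReal BoundedContinuousFunction unitInterval

namespace Summit.CriticalPhenomena.SAWScalingLimit.Theorems.SimpleSubseqLimits.SlitSplit

open Summit.CriticalPhenomena.SAWScalingLimit.Theses.SAWLoopFugacityFlow
  (SimpleSubseqLimits AvoidanceLimit SeqSlitAvoidance LimitAvoidanceValues SlitSplitGlue)
open Summit.CriticalPhenomena.SAWScalingLimit.Theorems.SimpleSubseqLimits.Negative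
  (SimpleSubseqLimitsCore simpleSubseqLimits_iff_core)
open Summit.CriticalPhenomena.SAWScalingLimit.Theorems.SimpleSubseqLimits.PastShadowing.Main
  (AvoidanceValues)
open Summit.CriticalPhenomena.SAWScalingLimit.Theorems.SimpleSubseqLimits.FarPast.RouteResidual
  (avoidanceValues_of_avoidanceLimit)
open Summit.CriticalPhenomena.SAWScalingLimit.Theorems.SimpleSubseqLimits.SlitRestriction.Transfer
  (SequentialSlitAvoidance)
open Summit.CriticalPhenomena.SAWScalingLimit.Theorems.SimpleSubseqLimits.SlitRestriction.Line
  (core_of_seqSlitAvoidance line_slitContinuousRestriction)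

/-! ## Read-backs: the route decls ARE the Theorems-side statements (definitional) -/

/-- The child item's route text is the landed line's open input, definitionally (cf. lead c9's
`Lines/seqslit_route_vocab_check.lean`). [folklore] -/
theorem seqSlitAvoidance_iff : SeqSlitAvoidance ↔ SequentialSlitAvoidance := Iff.rfl

/-- The proxy child's route text is the landed SHAPE interface, definitionally (cf. strategist s2's
`avoidanceValuesText_iff`). [folklore] -/
theorem limitAvoidanceValues_iff : LimitAvoidanceValues ↔ AvoidanceValues := Iff.rfl

/-! ## Assembly (PROVED; landed twin `line_slitContinuousRestriction`, p154999) -/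

/-- **ASSEMBLY `X₁ → X₂ → X`.** Sequential slit avoidance and the A-side give the crux BY NAME, through the
landed line `slit-continuous-restriction` (ten Theorems files; p154999 is the closing). [folklore] -/
theorem SimpleSubseqLimits_of : SeqSlitAvoidance → AvoidanceLimit → SimpleSubseqLimits :=
  fun h hA => line_slitContinuousRestriction (seqSlitAvoidance_iff.1 h) hA

/-- The filed proxy child follows from piece X₂ (landed `RouteResidual.avoidanceValues_of_avoidanceLimit`:
A-side + proved `AvoidancePassage` + proved `SLEAvoidanceValue`). [folklore] -/
theorem limitAvoidanceValues_of_avoidanceLimit : AvoidanceLimit → LimitAvoidanceValues :=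
  fun hA => limitAvoidanceValues_iff.2 (avoidanceValues_of_avoidanceLimit hA)

/-- **The filed glue item `SlitSplitGlue` (stmt-CriticalPhenomena-18171), PROVED**: the route-neutral core
of the landed line (`core_of_seqSlitAvoidance`) + `Negative.simpleSubseqLimits_iff_core`. [folklore] -/
theorem slitSplitGlue_proof : SlitSplitGlue :=
  show SeqSlitAvoidance → LimitAvoidanceValues → SimpleSubseqLimits from
    fun h hV => simpleSubseqLimits_iff_core.2
      (core_of_seqSlitAvoidance (seqSlitAvoidance_iff.1 h) (limitAvoidanceValues_iff.1 hV))

/-- The filed split's assembly as an implication. [folklore] -/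
theorem SimpleSubseqLimits_of_filedSplit : SeqSlitAvoidance → LimitAvoidanceValues → SimpleSubseqLimits :=
  slitSplitGlue_proof

/-- The two decompositions agree: X₁ ∧ X₂ ⟹ X₁ ∧ proxy ⟹ X. [folklore] -/
theorem SimpleSubseqLimits_of' : SeqSlitAvoidance → AvoidanceLimit → SimpleSubseqLimits :=
  fun h hA => SimpleSubseqLimits_of_filedSplit h (limitAvoidanceValues_of_avoidanceLimit hA)

end Summit.CriticalPhenomena.SAWScalingLimit.Theorems.SimpleSubseqLimits.SlitSplit

end
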